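import Literature.NumberTheory.LFunctions.TwistedDedekindCoefficients
import HarnessLib

/-!
# The `3-4-1` positivity for a REAL ideal character with the Dedekind third term

Complement to `TwistedDedekindCoefficients.three_four_one` (MV Lemma 11.2 over a number field `K`:
`3 Re L(Λ_K, σ) + 4 Re L(νΛ, σ+it) + Re L(ν²Λ, σ+2it) ≥ 0`). For a **real** character `ν`
(`ν(𝔞) ∈ [−1, 1]`, e.g. a quadratic ray-class character extended by `0`) the third series may be
taken to be the Dedekind one, `L(Λ_K, σ + 2it)`, WITHOUT restricting to the ideals where `ν ≠ 0`:
termwise `3 + 4r cos θ + cos 2θ = 2(cos θ + r)² + 2(1 − r²) ≥ 0` for `|r| ≤ 1` (`three_four_one_real`).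
This is the form of the `3-4-1` datum used for the exceptional (real) characters in the zero-free
region of twisted `L`-functions (`TwistedZFRData` with `pole = true`, `Λ₂ = Λ_K`), where the companion
bound `Re L(Λ₂, s) ≤ Re 1/(s−1) + C log(|t|+4)` is then de la Vallée Poussin's for `ζ_K` — avoiding the
Euler factors at the primes dividing the modulus. (T. Mitsui 1956, Lemma 5; Heath-Brown 2001, Lemma 9.4.)
Everything is PROVED; no definitions.

## References

* H. L. Montgomery, R. C. Vaughan, *Multiplicative Number Theory I*, CUP 2007, Lemma 11.2 and §11.1
  Case 3 (real characters). [cite: MontgomeryVaughan2007, Lemma 11.2]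
* D. R. Heath-Brown, *Primes represented by `x³ + 2y³`*, Acta Math. 186 (2001), §9 p. 55. [cite: HeathBrownActa2001, §9 Lemma 9.4]

## Mathlib / tree search

Tree: `TwistedDedekindCoefficients` (`term_eq_inv_rpow_mul`, `vonMangoldtNorm`, `twistVonMangoldt`,
`LSeriesSummable_vonMangoldtNorm`, `LSeriesSummable_twistVonMangoldt`, `idealVonMangoldt_nonneg`).
Mathlib: `Complex.norm_natCast_cpow_of_pos`, `HasSum.mapL`, `Complex.reCLM`.
-/

noncomputable section

open Complex Finset
open scoped NumberField

namespace Literature.NumberTheory.LFunctions.NumberField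

variable {K : Type*} [Field K] [NumberField K] {ν : Ideal (𝓞 K) →*₀ ℂ}

/-- `3 + 4 r Re e + Re e² ≥ 0` for real `|r| ≤ 1` and `|e| = 1`:
`= 2(Re e + r)² + 2(1 − r²)`. [cite: MontgomeryVaughan2007, Lemma 11.2] -/
theorem three_four_one_re_real_nonneg {r : ℝ} (hr : |r| ≤ 1) {e : ℂ} (he : ‖e‖ = 1) :
    0 ≤ 3 + 4 * (r * e.re) + (e ^ 2).re := by
  have h1 : e.re ^ 2 + e.im ^ 2 = 1 := by
    have := Complex.normSq_eq_norm_sq e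
    rw [he, one_pow, Complex.normSq_apply] at this
    nlinarith
  have h2 : (e ^ 2).re = 2 * e.re ^ 2 - 1 := by
    rw [sq, Complex.mul_re]; nlinarith
  rw [h2]
  have hr2 : r ^ 2 ≤ 1 := by
    have := abs_le.1 hr; nlinarith
  nlinarith [sq_nonneg (e.re + r)]

/-- Termwise positivity with the Dedekind third term, for a real character. [cite: MontgomeryVaughan2007, Lemma 11.2] -/
theorem re_three_four_one_terms_real_nonneg (hν : ∀ I, ‖ν I‖ ≤ 1) (hreal : ∀ I, (ν I).im = 0)
    (σ t : ℝ) (n : ℕ) :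
    0 ≤ 3 * (LSeries.term (fun n ↦ (vonMangoldtNorm K n : ℂ)) σ n).re +
      4 * (LSeries.term (twistVonMangoldt K ν) (σ + t * I) n).re +
        (LSeries.term (fun n ↦ (vonMangoldtNorm K n : ℂ)) (σ + 2 * t * I) n).re := by
  rcases eq_or_ne n 0 with rfl | hn
  · simp
  have hn0 : (n : ℂ) ≠ 0 := Nat.cast_ne_zero.2 hn
  set r : ℝ := ((n : ℝ) ^ σ)⁻¹ with hr
  have hr0 : 0 ≤ r := by positivity
  set e : ℂ := (n : ℂ) ^ (-(t * I)) with he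
  have he1 : ‖e‖ = 1 := by
    rw [he, Complex.norm_natCast_cpow_of_pos (Nat.pos_of_ne_zero hn)]
    simp
  have he2 : (n : ℂ) ^ (-((2 * t : ℝ) * I)) = e ^ 2 := by
    rw [he, sq, ← Complex.cpow_add _ _ hn0]
    congr 1; push_cast; ring
  have hA : LSeries.term (fun n ↦ (vonMangoldtNorm K n : ℂ)) σ n = ((r * vonMangoldtNorm K n : ℝ) : ℂ) := by
    have := term_eq_inv_rpow_mul (fun n ↦ (vonMangoldtNorm K n : ℂ)) σ 0 hn
    simp only [Complex.ofReal_zero, zero_mul, add_zero, neg_zero, Complex.cpow_zero, mul_one] at this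
    rw [this, hr]; push_cast; ring
  have hB : LSeries.term (twistVonMangoldt K ν) (σ + t * I) n = (r : ℂ) * (twistVonMangoldt K ν n * e) := by
    rw [term_eq_inv_rpow_mul _ σ t hn]
  have hC : LSeries.term (fun n ↦ (vonMangoldtNorm K n : ℂ)) (σ + 2 * t * I) n =
      (r : ℂ) * ((vonMangoldtNorm K n : ℂ) * e ^ 2) := by
    have := term_eq_inv_rpow_mul (fun n ↦ (vonMangoldtNorm K n : ℂ)) σ (2 * t) hn
    rw [he2] at this
    rw [← this]
    congr 1; push_cast; ring
  rw [hA, hB, hC, Complex.ofReal_re, Complex.re_ofReal_mul, Complex.re_ofReal_mul]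
  have hsum : 3 * (vonMangoldtNorm K n : ℂ) + 4 * (twistVonMangoldt K ν n * e) +
      (vonMangoldtNorm K n : ℂ) * e ^ 2 =
      ∑ B ∈ idealsOfNorm K n, (idealVonMangoldt B : ℂ) * (3 + 4 * (ν B * e) + e ^ 2) := by
    unfold vonMangoldtNorm twistVonMangoldt
    push_cast
    rw [Finset.mul_sum, Finset.sum_mul, Finset.sum_mul, Finset.mul_sum, ← Finset.sum_add_distrib,
      ← Finset.sum_add_distrib]
    refine Finset.sum_congr rfl fun B _ ↦ ?_
    ring
  have hre : 0 ≤ (3 * (vonMangoldtNorm K n : ℂ) + 4 * (twistVonMangoldt K ν n * e) +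
      (vonMangoldtNorm K n : ℂ) * e ^ 2).re := by
    rw [hsum, Complex.re_sum]
    refine Finset.sum_nonneg fun B _ ↦ ?_
    rw [Complex.re_ofReal_mul]
    refine mul_nonneg (idealVonMangoldt_nonneg B) ?_
    have hνB : ν B = ((ν B).re : ℂ) := by
      apply Complex.ext <;> simp [hreal B]
    have hrB : |(ν B).re| ≤ 1 := (Complex.abs_re_le_norm _).trans (hν B)
    have key := three_four_one_re_real_nonneg hrB he1
    have : (3 + 4 * (ν B * e) + e ^ 2).re = 3 + 4 * ((ν B).re * e.re) + (e ^ 2).re := by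
      rw [hνB]
      simp [Complex.add_re, Complex.mul_re]
    rw [this]; exact key
  have hre' : (3 * (vonMangoldtNorm K n : ℂ) + 4 * (twistVonMangoldt K ν n * e) +
      (vonMangoldtNorm K n : ℂ) * e ^ 2).re =
      3 * vonMangoldtNorm K n + 4 * (twistVonMangoldt K ν n * e).re +
        ((vonMangoldtNorm K n : ℂ) * e ^ 2).re := by
    simp only [Complex.add_re, Complex.mul_re, Complex.re_ofNat,
      Complex.im_ofNat, Complex.ofReal_re, Complex.ofReal_im]
    ring
  rw [hre'] at hre
  have := mul_nonneg hr0 hre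
  nlinarith

/-- **MV Lemma 11.2 over `K` for a real character, Dedekind third term**: for `σ > 1`, real `t`,
`|ν| ≤ 1` with `ν` real-valued,
`3 Re L(Λ_K, σ) + 4 Re L(νΛ, σ + it) + Re L(Λ_K, σ + 2it) ≥ 0`. [cite: MontgomeryVaughan2007, Lemma 11.2] -/
theorem three_four_one_real (hν : ∀ I, ‖ν I‖ ≤ 1) (hreal : ∀ I, (ν I).im = 0) {σ : ℝ} (hσ : 1 < σ)
    (t : ℝ) :
    0 ≤ 3 * (LSeries (fun n ↦ (vonMangoldtNorm K n : ℂ)) σ).re +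
      4 * (LSeries (twistVonMangoldt K ν) (σ + t * I)).re +
        (LSeries (fun n ↦ (vonMangoldtNorm K n : ℂ)) (σ + 2 * t * I)).re := by
  have hs1 : 1 < (σ : ℂ).re := by simp [hσ]
  have hs2 : 1 < ((σ : ℂ) + t * I).re := by simp [hσ]
  have hs3 : 1 < ((σ : ℂ) + 2 * t * I).re := by simp [hσ]
  have hA := (LSeriesSummable_vonMangoldtNorm (K := K) hs1).hasSum
  have hB := (LSeriesSummable_twistVonMangoldt hν hs2).hasSum
  have hC := (LSeriesSummable_vonMangoldtNorm (K := K) hs3).hasSum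
  have hsum := ((hA.mul_left 3).add ((hB.mul_left 4).add hC)).mapL Complex.reCLM
  simp only [Complex.reCLM_apply] at hsum
  have hre : (3 * LSeries (fun n ↦ (vonMangoldtNorm K n : ℂ)) σ +
      (4 * LSeries (twistVonMangoldt K ν) (σ + t * I) +
        LSeries (fun n ↦ (vonMangoldtNorm K n : ℂ)) (σ + 2 * t * I))).re =
      3 * (LSeries (fun n ↦ (vonMangoldtNorm K n : ℂ)) σ).re +
        4 * (LSeries (twistVonMangoldt K ν) (σ + t * I)).re +
          (LSeries (fun n ↦ (vonMangoldtNorm K n : ℂ)) (σ + 2 * t * I)).re := by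
    simp only [Complex.add_re, Complex.mul_re, Complex.re_ofNat, Complex.im_ofNat]; ring
  rw [← hre]
  refine hsum.nonneg fun n ↦ ?_
  have h := re_three_four_one_terms_real_nonneg hν hreal σ t n
  simp only [Complex.add_re, Complex.mul_re, Complex.re_ofNat, Complex.im_ofNat, zero_mul, sub_zero]
  linarith [h]

end Literature.NumberTheory.LFunctions.NumberField
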